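import Summits.QuantumFields.YangMills.Theorems.UnitScaleTiltHistoryTailBoundedHeight
import Literature.MathematicalPhysics.QuantumFieldTheory.Balaban1983to89.BlockAveragingPlaquetteBoundLocal

/-!
# Crux `HistoryTailL` (stmt-QuantumFields-19936) — THE PER-PLAQUETTE LARGE-FIELD TAIL AT BOUNDED HEIGHT WITH VOLUME-UNIFORM CONSTANTS:
# the bounded-height schema of `HistoryTailBoundedHeight` LOCALISED (constants depending on `L` and the height cap `j₀` only, NOT on the family)

Cell `ym3-torus` (YM ladder rung R3 = continuum SU(2) Yang–Mills on the three-torus; NOT the Clay problem), width seat `ym-ust-19936-w2` gen 8.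
The tree's `HistoryTailBoundedHeight.unitScaleTilt_perPlaquette_boundedHeight` proves, for every family `F`, `0 < γ ≤ 1`, `b₀ ≥ 0` and every height
cap `j₀`, the Gaussian-in-threshold per-plaquette schema `Gibbs_K{θ(K−j) ≤ |Ū^{j}(∂p) − 1|} ≤ C·β_{K−j}^A·exp(−c·p(g_{K−j})²)` for `j ≤ min(K, j₀)` —
but with `C = 144e^{24}c₀^{−3}·L^{3m+8j₀}` carrying the VOLUME `L^{3·F.m}` of the family, because the deterministic step transports the event into the
GLOBAL fine large-field event `{¬PlaqSmall (θ/Λ^j)}` (union over ALL fine plaquettes).  The sibling route `CovariantDischarge` (ideator line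
«covariant_discharge» on the crux, 2026-08-28) asks the bounded-depth window tails with constants fixed BEFORE the family (`LevelOneWindowTailL`,
stmt-QuantumFields-22894; `stub_boundedDepth`).  THIS FILE supplies exactly that, by LOCALITY:

* §1 `exists_near_finset` — the level-`s` plaquettes whose base block is within `ℓ^∞`-distance `1` of the corner of a plaquette in a finite set `S`
  of level-`(s+1)` plaquettes lie in a finite set of size `≤ 81·L³·#S` (`27` neighbouring blocks × `L³` sites (`Site.blockEquiv`) × `3` plane labels);
* §2 `exists_footprint` — iterating, every finite set `S` of level-`j` plaquettes has a FOOTPRINT `T ⊆ Plaq(T^{(0)})`, `#T ≤ (81L³)^j·#S`, such that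
  `PlaqSmallOn T a U ⇒ PlaqSmallOn S (Λ^j·a) (Ū^{j})` (`Λ = 151L²`; the tree's LOCAL crude Prop 1 `BlockAveragingPlaquetteBoundLocal.plaqSmallOn_avgFun_of_near`
  iterated under the guards `(25L²/4)·Λ^s·a < δ₂`);
* §3 `gibbsK_real_event_le_sum_footprint` — hence the height-`j` large-plaquette event at `p` (threshold `0 ≤ θ ≤ 2`) has Gibbs mass at most
  `Σ_{q ∈ T_p} Gibbs_K{θ/Λ^j ≤ |U(∂q) − 1|}` with `#T_p ≤ (81L³)^j`;
* §4 **`perPlaquette_boundedHeight_uniform`** — with the VOLUME-UNIFORM per-fine-plaquette chessboard bound `T3FinestHeightTail.gibbsMeasure_real_dist1_ge_le`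
  (reflection positivity + small Haar balls) and the arithmetic of `HistoryTailBoundedHeight` (`β_K = L^jβ_{K−j}`, `β_{K−j}θ(K−j)² = p(g_{K−j})²`):
  for every `L`, `j₀` there are `C ≥ 0`, `c > 0` such that for EVERY family `F` with `F.L = L`, every `0 < γ ≤ 1`, `b₀ ≥ 0`, `p₀`, `K`, `j ≤ min(K, j₀)`, `p`:
  `Gibbs_K{θ(K−j) ≤ |Ū^{j}(∂p) − 1|} ≤ C·β_{K−j}^5·exp(−c·p(g_{K−j})²)` with `C = (81L³)^{j₀}·2e^{24}c₀^{−3}·L^{5j₀}`, `c = ¼·Λ^{−2j₀}`.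

WHAT THIS IS NOT.  Bounded height only (the constants degrade like `(81L³)^{j₀}`, `Λ^{−2j₀}`): the height-uniform content of K2 ∕ `HistoryTailL`, the routes'
fractional- and deep-depth cruxes, the rung R3, d = 4, a continuum limit or a mass gap are NOT proved.  YM₃ on T³ is rung R3, NOT the Clay problem.

References: T. Bałaban, CMP **98** (1985) 17–51 [Balaban1985Averaging] (Prop. 1 (51) p.26, locality p.24 after (43)); CMP **102** (1985) 255–275
[Balaban1985UV3] ((7) p.257, (11) p.258, (71) p.273); J. Fröhlich, R. Israel, E. Lieb, B. Simon, CMP 62 (1978) [FrohlichIsraelLiebSimon1978] (Thm 4.1).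
-/

noncomputable section

open MeasureTheory
open scoped BigOperators
open Literature.MathematicalPhysics.QuantumFieldTheory.Balaban1983to89
open Literature.MathematicalPhysics.QuantumFieldTheory.Balaban1983to89.T3ContinuumYM3Torus
open Literature.MathematicalPhysics.QuantumFieldTheory.Balaban1983to89.T3UnitScaleTilt
open Literature.MathematicalPhysics.QuantumFieldTheory.Balaban1983to89.T3UnitLawDensityEML
open Literature.MathematicalPhysics.QuantumFieldTheory.Balaban1983to89.T3FinestHeightTail
open Literature.MathematicalPhysics.QuantumFieldTheory.Balaban1983to89.T3Thresholds
open Literature.MathematicalPhysics.QuantumFieldTheory.Balaban1983to89.BlockAveragingPlaquetteBoundLocal (plaqSmallOn_avgFun_of_near)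
open Literature.MathematicalPhysics.QuantumFieldTheory.Balaban1983to89.ExpMeanLog (deltaSU expMeanLogSU)
open Literature.MathematicalPhysics.QuantumFieldTheory.Balaban1983to89.T4PairDerivBridge (dist1_le_two_specialUnitaryGroup)
open Summit.QuantumFields.YangMills.Theorems.HistoryTailBoundedHeight (lam_eq one_le_lam lam_pos third_le_deltaSU_two scheme_β_add
  one_le_scheme_β pow_le_scheme_β θBal_nonneg')

namespace Summit.QuantumFields.YangMills.Theorems.HistoryTailBoundedHeightLocal

/-! ## §1 One step of the footprint: the plaquettes based in the `3^d` blocks around the corners of a finite set of coarse plaquettes -/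

section Near

variable (F : T3Family)

/-- There are three plane labels `μ < ν` in dimension `3`. [folklore] -/
theorem card_planePairs (K : ℕ) : Fintype.card {q : Fin (F.P K).d × Fin (F.P K).d // q.1 < q.2} = 3 := by
  rw [show (F.P K).d = 3 from rfl]; decide

/-- **THE NEIGHBOURHOOD OF A FINITE SET OF COARSE PLAQUETTES IS SMALL**: for a finite set `S` of plaquettes of `T^{(s+1)}` (standing range
`s + 1 ≤ m + K`), the plaquettes `q` of `T^{(s)}` whose base block `blockOf q₋` is coordinatewise within `1` of the corner of some `p ∈ S` lie in a
finite set of at most `81·L³·#S` plaquettes (`3³` neighbouring blocks, `L³` sites per block — `Site.blockEquiv` —, `3` plane labels).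
[cite: Balaban1987RG1, (0.3) p.252; Balaban1985Averaging, p.24 (after (43))] -/
theorem exists_near_finset {K s : ℕ} (hs : s + 1 ≤ (F.P K).m + (F.P K).K) (S : Finset (Plaq (F.P K) (s + 1))) :
    ∃ N : Finset (Plaq (F.P K) s), (N.card : ℝ) ≤ 81 * (F.L : ℝ) ^ 3 * S.card ∧
      {q : Plaq (F.P K) s | ∃ p ∈ (↑S : Set (Plaq (F.P K) (s + 1))), ∀ κ, blockOf q.src κ = p.src κ ∨
          blockOf q.src κ = p.src κ + 1 ∨ blockOf q.src κ = p.src κ - 1} ⊆ ↑N := by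
  classical
  -- the parametrisation: a plaquette of `S`, an offset pattern, a position in the block, a plane label
  let nb : Site (F.P K) (s + 1) → (Fin (F.P K).d → Fin 3) → Site (F.P K) (s + 1) :=
    fun y δ κ => y κ + ((δ κ : ℕ) : ZMod ((F.P K).sitesPerDir (s + 1))) - 1
  let g : Plaq (F.P K) (s + 1) × (Fin (F.P K).d → Fin 3) × (Fin (F.P K).d → Fin (F.P K).L) ×
      {q : Fin (F.P K).d × Fin (F.P K).d // q.1 < q.2} → Plaq (F.P K) s :=
    fun x => ⟨Site.blockSite (nb x.1.src x.2.1) x.2.2.1, x.2.2.2.1.1, x.2.2.2.1.2, x.2.2.2.2⟩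
  refine ⟨(S ×ˢ (Finset.univ ×ˢ (Finset.univ ×ˢ Finset.univ))).image g, ?_, ?_⟩
  · -- the count
    have hA : (Finset.univ : Finset (Fin (F.P K).d → Fin 3)).card = 27 := by
      rw [Finset.card_univ, Fintype.card_fun, Fintype.card_fin, Fintype.card_fin]; rfl
    have hB : (Finset.univ : Finset (Fin (F.P K).d → Fin (F.P K).L)).card = F.L ^ 3 := by
      rw [Finset.card_univ, Fintype.card_fun, Fintype.card_fin, Fintype.card_fin]; rfl
    have hCc : (Finset.univ : Finset {q : Fin (F.P K).d × Fin (F.P K).d // q.1 < q.2}).card = 3 := by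
      rw [Finset.card_univ, card_planePairs F K]
    have hcard := Finset.card_image_le (s := S ×ˢ ((Finset.univ : Finset (Fin (F.P K).d → Fin 3)) ×ˢ
      ((Finset.univ : Finset (Fin (F.P K).d → Fin (F.P K).L)) ×ˢ
        (Finset.univ : Finset {q : Fin (F.P K).d × Fin (F.P K).d // q.1 < q.2})))) (f := g)
    rw [Finset.card_product, Finset.card_product, Finset.card_product, hA, hB, hCc] at hcard
    calc (((S ×ˢ (Finset.univ ×ˢ (Finset.univ ×ˢ Finset.univ))).image g).card : ℝ)
        ≤ ((S.card * (27 * (F.L ^ 3 * 3)) : ℕ) : ℝ) := by exact_mod_cast hcard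
      _ = 81 * (F.L : ℝ) ^ 3 * S.card := by push_cast; ring
  · -- the inclusion
    rintro q ⟨p, hpS, hnear⟩
    -- the offset pattern realising `blockOf q₋`
    let δ : Fin (F.P K).d → Fin 3 := fun κ =>
      if blockOf q.src κ = p.src κ then 1 else if blockOf q.src κ = p.src κ + 1 then 2 else 0
    have hδ : nb p.src δ = blockOf q.src := by
      funext κ
      show p.src κ + ((δ κ : ℕ) : ZMod ((F.P K).sitesPerDir (s + 1))) - 1 = blockOf q.src κ
      by_cases h0 : blockOf q.src κ = p.src κ
      · have hδκ : δ κ = 1 := by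
          show (if blockOf q.src κ = p.src κ then (1 : Fin 3) else if blockOf q.src κ = p.src κ + 1 then 2 else 0) = 1
          rw [if_pos h0]
        rw [hδκ, h0, Fin.val_one, Nat.cast_one]; ring
      · by_cases h1 : blockOf q.src κ = p.src κ + 1
        · have hδκ : δ κ = 2 := by
            show (if blockOf q.src κ = p.src κ then (1 : Fin 3) else if blockOf q.src κ = p.src κ + 1 then 2 else 0) = 2
            rw [if_neg h0, if_pos h1]
          rw [hδκ, h1, Fin.val_two, Nat.cast_ofNat]; ring
        · have hδκ : δ κ = 0 := by
            show (if blockOf q.src κ = p.src κ then (1 : Fin 3) else if blockOf q.src κ = p.src κ + 1 then 2 else 0) = 0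
            rw [if_neg h0, if_neg h1]
          have h2 : blockOf q.src κ = p.src κ - 1 := by
            rcases hnear κ with h | h | h
            · exact absurd h h0
            · exact absurd h h1
            · exact h
          rw [hδκ, h2, Fin.val_zero, Nat.cast_zero]; ring
    -- the position of `q₋` in its block
    let r : Fin (F.P K).d → Fin (F.P K).L := Site.blockEquiv hs (blockOf q.src) ⟨q.src, rfl⟩
    have hr : Site.blockSite (blockOf q.src) r = q.src := by
      have h := (Site.blockEquiv hs (blockOf q.src)).symm_apply_apply ⟨q.src, rfl⟩
      exact congrArg Subtype.val h
    refine Finset.mem_image.mpr ⟨(p, δ, r, ⟨(q.μ, q.ν), q.hμν⟩), ?_, ?_⟩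
    · simp only [Finset.mem_product, Finset.mem_univ, and_true]
      exact hpS
    · show (⟨Site.blockSite (nb p.src δ) r, q.μ, q.ν, q.hμν⟩ : Plaq (F.P K) s) = q
      rw [hδ, hr]

end Near

/-! ## §2 The footprint of a finite set of height-`j` plaquettes and the local iterate of the crude Prop 1 -/

section Footprint

variable (F : T3Family)

/-- **THE FOOTPRINT AND THE LOCAL `j`-FOLD AVERAGING OF A SMALL FIELD**: every finite set `S` of plaquettes of `T^{(j)}` (`j ≤ K`) has a finite
FOOTPRINT `T ⊆ Plaq(T^{(0)})` with `#T ≤ (81L³)^j·#S` such that, for every radius `a ≥ 0` obeying the guards `(25L²/4)·Λ^s·a < δ₂` (`s < j`,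
`Λ = 151L²`) and every fine configuration `U`: if the fine plaquettes of `T` are `a`-small then the plaquettes of `S` of the `j`-fold (0.4) average
`Ū^{j}` are `Λ^j·a`-small — the tree's LOCAL crude Prop 1 (`plaqSmallOn_avgFun_of_near`) iterated, §1 for the count.
[cite: Balaban1985Averaging, Prop. 1 (51) p.26 and p.24 (after (43))] -/
theorem exists_footprint (K : ℕ) :
    ∀ j : ℕ, j ≤ K → ∀ S : Finset (Plaq (F.P K) j), ∃ T : Finset (Plaq (F.P K) 0),
      (T.card : ℝ) ≤ (81 * (F.L : ℝ) ^ 3) ^ j * S.card ∧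
      ∀ (a : ℝ), 0 ≤ a → (∀ s, s < j → ((((3 + 2) * F.L : ℕ) : ℝ) ^ 2 / 4) * ((151 * (F.L : ℝ) ^ 2) ^ s * a) < deltaSU (Fin 2)) →
        ∀ U : GaugeField (F.P K) 0 (Matrix.specialUnitaryGroup (Fin 2) ℂ),
          PlaqSmallOn (↑T : Set (Plaq (F.P K) 0)) a U →
            PlaqSmallOn (↑S : Set (Plaq (F.P K) j)) ((151 * (F.L : ℝ) ^ 2) ^ j * a)
              (Averaging.iter (fun _ => BlockAveraging.blockAvg ℰp) j U)
  | 0, _, S => by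
    refine ⟨S, by rw [pow_zero, one_mul], fun a _ _ U hU => ?_⟩
    show PlaqSmallOn (↑S : Set (Plaq (F.P K) 0)) ((151 * (F.L : ℝ) ^ 2) ^ 0 * a) U
    rw [pow_zero, one_mul]; exact hU
  | j + 1, hjK, S => by
    have hj : j + 1 ≤ (F.P K).m + (F.P K).K := by
      show j + 1 ≤ F.m + K; omega
    obtain ⟨N, hNcard, hNsub⟩ := exists_near_finset F hj S
    obtain ⟨T, hTcard, hT⟩ := exists_footprint K j (by omega) N
    refine ⟨T, ?_, fun a ha hguard U hU => ?_⟩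
    · have h81 : (0 : ℝ) ≤ (81 * (F.L : ℝ) ^ 3) ^ j := by positivity
      calc (T.card : ℝ) ≤ (81 * (F.L : ℝ) ^ 3) ^ j * N.card := hTcard
        _ ≤ (81 * (F.L : ℝ) ^ 3) ^ j * (81 * (F.L : ℝ) ^ 3 * S.card) := mul_le_mul_of_nonneg_left hNcard h81
        _ = (81 * (F.L : ℝ) ^ 3) ^ (j + 1) * S.card := by rw [pow_succ]; ring
    · have hN := hT a ha (fun s hs => hguard s (by omega)) U hU
      have ha' : 0 ≤ (151 * (F.L : ℝ) ^ 2) ^ j * a := mul_nonneg (pow_nonneg (lam_pos F).le j) ha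
      have hN' : PlaqSmallOn {q : Plaq (F.P K) j | ∃ p ∈ (↑S : Set (Plaq (F.P K) (j + 1))), ∀ κ, blockOf q.src κ = p.src κ ∨
          blockOf q.src κ = p.src κ + 1 ∨ blockOf q.src κ = p.src κ - 1} ((151 * (F.L : ℝ) ^ 2) ^ j * a)
          (Averaging.iter (fun _ => BlockAveraging.blockAvg ℰp) j U) :=
        fun q hq => hN q (hNsub hq)
      have hstep := plaqSmallOn_avgFun_of_near (P := F.P K) (n := Fin 2) hj ha' (↑S : Set (Plaq (F.P K) (j + 1))) hN'
        (hguard j (Nat.lt_succ_self j))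
      intro p hp
      have h := hstep p hp
      refine h.trans_le (le_of_eq ?_)
      show ((F.L : ℝ) ^ 2 + 6 * (((3 + 2) * F.L : ℕ) : ℝ) ^ 2) * ((151 * (F.L : ℝ) ^ 2) ^ j * a) =
        (151 * (F.L : ℝ) ^ 2) ^ (j + 1) * a
      rw [lam_eq, pow_succ]; ring

/-- **THE HEIGHT-`j` LARGE-PLAQUETTE EVENT AT `p` IS COVERED BY THE FINE TAILS OVER THE FOOTPRINT OF `p`** (`0 ≤ θ ≤ 2`, `j ≤ K`): there is a finite
set `T ⊆ Plaq(T^{(0)})`, `#T ≤ (81L³)^j`, with `Gibbs_K{θ ≤ |Ū^{j}(∂p) − 1|} ≤ Σ_{q ∈ T} Gibbs_K{θ/Λ^j ≤ |U(∂q) − 1|}` (the guards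
`(25L²/4)·θ/Λ ≤ 50/604 < δ₂` hold automatically, as in `HistoryTailBoundedHeight.event_subset_not_plaqSmall`). [cite: Balaban1985Averaging, Prop. 1 (51) p.26] -/
theorem gibbsK_real_event_le_sum_footprint {γ : ℝ} (hγ : 0 ≤ γ) {K j : ℕ} (hjK : j ≤ K) {θ : ℝ} (hθ0 : 0 ≤ θ) (hθ2 : θ ≤ 2)
    (p : Plaq (F.P K) j) :
    ∃ T : Finset (Plaq (F.P K) 0), (T.card : ℝ) ≤ (81 * (F.L : ℝ) ^ 3) ^ j ∧
      (gibbsK F ℰp γ K).real {U : GaugeField (F.P K) 0 (Matrix.specialUnitaryGroup (Fin 2) ℂ) |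
          θ ≤ GaugeGroup.dist1 (GaugeField.plaqHol (Averaging.iter (fun _ => BlockAveraging.blockAvg ℰp) j U) p)} ≤
        ∑ q ∈ T, (gibbsK F ℰp γ K).real {U : GaugeField (F.P K) 0 (Matrix.specialUnitaryGroup (Fin 2) ℂ) |
          θ / (151 * (F.L : ℝ) ^ 2) ^ j ≤ GaugeGroup.dist1 (GaugeField.plaqHol U q)} := by
  classical
  obtain ⟨T, hTcard, hT⟩ := exists_footprint F K j hjK {p}
  refine ⟨T, by simpa using hTcard, ?_⟩
  have hΛ := lam_pos F
  have hΛj : 0 < (151 * (F.L : ℝ) ^ 2) ^ j := pow_pos hΛ j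
  have ha : 0 ≤ θ / (151 * (F.L : ℝ) ^ 2) ^ j := div_nonneg hθ0 hΛj.le
  -- the guard at every step `s < j`
  have hguard : ∀ s, s < j → ((((3 + 2) * F.L : ℕ) : ℝ) ^ 2 / 4) * ((151 * (F.L : ℝ) ^ 2) ^ s * (θ / (151 * (F.L : ℝ) ^ 2) ^ j)) <
      deltaSU (Fin 2) := by
    intro s hs
    have hL : (1 : ℝ) ≤ F.L := by exact_mod_cast F.hL.2.le
    have hL2 : 0 < (F.L : ℝ) ^ 2 := by positivity
    have hratio : (151 * (F.L : ℝ) ^ 2) ^ s * (θ / (151 * (F.L : ℝ) ^ 2) ^ j) ≤ θ / (151 * (F.L : ℝ) ^ 2) := by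
      rw [mul_div_assoc', div_le_div_iff₀ hΛj hΛ]
      have hpow : (151 * (F.L : ℝ) ^ 2) ^ s * (151 * (F.L : ℝ) ^ 2) ≤ (151 * (F.L : ℝ) ^ 2) ^ j := by
        rw [← pow_succ]
        exact pow_le_pow_right₀ (one_le_lam F) (by omega)
      calc (151 * (F.L : ℝ) ^ 2) ^ s * θ * (151 * (F.L : ℝ) ^ 2) = θ * ((151 * (F.L : ℝ) ^ 2) ^ s * (151 * (F.L : ℝ) ^ 2)) := by ring
        _ ≤ θ * (151 * (F.L : ℝ) ^ 2) ^ j := mul_le_mul_of_nonneg_left hpow hθ0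
    have hcast : (((3 + 2) * F.L : ℕ) : ℝ) = 5 * F.L := by push_cast; ring
    rw [hcast]
    calc (5 * (F.L : ℝ)) ^ 2 / 4 * ((151 * (F.L : ℝ) ^ 2) ^ s * (θ / (151 * (F.L : ℝ) ^ 2) ^ j))
        ≤ (5 * (F.L : ℝ)) ^ 2 / 4 * (θ / (151 * (F.L : ℝ) ^ 2)) := mul_le_mul_of_nonneg_left hratio (by positivity)
      _ = 25 * θ / 604 := by field_simp; ring
      _ < 1 / 3 := by linarith
      _ ≤ deltaSU (Fin 2) := third_le_deltaSU_two
  -- the event lies in the union of the fine tails over the footprint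
  have hsub : {U : GaugeField (F.P K) 0 (Matrix.specialUnitaryGroup (Fin 2) ℂ) |
        θ ≤ GaugeGroup.dist1 (GaugeField.plaqHol (Averaging.iter (fun _ => BlockAveraging.blockAvg ℰp) j U) p)} ⊆
      ⋃ q ∈ T, {U : GaugeField (F.P K) 0 (Matrix.specialUnitaryGroup (Fin 2) ℂ) |
        θ / (151 * (F.L : ℝ) ^ 2) ^ j ≤ GaugeGroup.dist1 (GaugeField.plaqHol U q)} := by
    intro U hU
    by_contra hnot
    have hsmall : PlaqSmallOn (↑T : Set (Plaq (F.P K) 0)) (θ / (151 * (F.L : ℝ) ^ 2) ^ j) U := by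
      intro q hq
      by_contra hq'
      exact hnot (Set.mem_biUnion (Finset.mem_coe.mpr hq) (not_lt.mp hq'))
    have hiter := hT _ ha hguard U hsmall p (by simp)
    rw [div_eq_mul_inv, ← mul_assoc, mul_comm ((151 * (F.L : ℝ) ^ 2) ^ j), mul_assoc, mul_inv_cancel₀ hΛj.ne', mul_one] at hiter
    exact absurd hU (not_le.mpr hiter)
  haveI := isProbabilityMeasure_gibbsK F ℰp hγ K
  exact (measureReal_mono hsub (measure_ne_top _ _)).trans (measureReal_biUnion_finset_le T _)

end Footprint

/-! ## §3 The per-plaquette schema at bounded height with volume-uniform constants -/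

section Main

/-- **THE PER-PLAQUETTE LARGE-FIELD TAIL OF THE BLOCK-AVERAGED FIELDS AT BOUNDED HEIGHT, WITH CONSTANTS DEPENDING ON `L` AND `j₀` ONLY.**  For
every `L` and every height cap `j₀` there are `C ≥ 0`, `c > 0` such that for EVERY family `F` with `F.L = L` (any volume exponent `F.m`), every
coupling `0 < γ ≤ 1`, every profile `b₀ ≥ 0`, `p₀`, every cut-off `K`, every height `j ≤ min(K, j₀)` and every plaquette `p` of `T^{(j)}`:
`Gibbs_K{θ(K−j) ≤ |Ū^{j}(∂p) − 1|} ≤ C·β_{K−j}^5·exp(−c·p(g_{K−j})²)` (`C = (81L³)^{j₀}·2e^{24}c₀^{−3}·L^{5j₀}`, `c = ¼(151L²)^{−2j₀}`).  Local crude Prop 1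
iterated (§2) + the volume-uniform per-plaquette chessboard bound `gibbsMeasure_real_dist1_ge_le` over the footprint + the arithmetic of
`HistoryTailBoundedHeight` (`β_K = L^jβ_{K−j}`, `β_{K−j}θ² = p²`, `L^j/Λ^{2j} ≥ Λ^{−2j₀}`).  Bounded height only; nothing height-uniform is claimed.
[cite: Balaban1985UV3, (7) p.257, (11) p.258 and (71) p.273; Balaban1985Averaging, Prop. 1 (51) p.26; FrohlichIsraelLiebSimon1978, Thm 4.1] -/
theorem perPlaquette_boundedHeight_uniform (L j₀ : ℕ) :
    ∃ (C c : ℝ), 0 ≤ C ∧ 0 < c ∧ ∀ (F : T3Family), F.L = L → ∀ (γ : ℝ), 0 < γ → γ ≤ 1 → ∀ (b₀ : ℝ), 0 ≤ b₀ → ∀ (p₀ : ℝ)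
      (K j : ℕ), j ≤ K → j ≤ j₀ → ∀ p : Plaq (F.P K) j,
        (gibbsK F ℰp γ K).real
            {U | θBal F.L γ b₀ p₀ (K - j) ≤
              GaugeGroup.dist1 (GaugeField.plaqHol
                (Averaging.iter (fun _ => BlockAveraging.blockAvg ℰp) j U) p)} ≤
          C * (F.scheme ℰp γ).β (K - j) ^ 5 *
            Real.exp (-(c * B10.pFun b₀ p₀ (Real.sqrt (γ * ((F.L : ℝ)⁻¹) ^ (K - j))) ^ 2)) := by
  obtain ⟨c₀, hc₀, _, hch⟩ := gibbsMeasure_real_dist1_ge_le (N := 2)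
  -- degenerate block size: no family has `F.L = L ≤ 1`, the constants are irrelevant
  by_cases hL : 1 < L
  swap
  · refine ⟨0, 1, le_rfl, one_pos, fun F hFL => absurd (hFL ▸ F.hL.2) hL⟩
  have hLr : (1 : ℝ) < L := by exact_mod_cast hL
  have hLr0 : (0 : ℝ) < L := one_pos.trans hLr
  have hΛL : (0 : ℝ) < 151 * (L : ℝ) ^ 2 := by positivity
  -- the constants (depending on `L` and `j₀` only)
  refine ⟨(81 * (L : ℝ) ^ 3) ^ j₀ * (2 * Real.exp 24 * (c₀ ^ 3)⁻¹) * (L : ℝ) ^ (5 * j₀),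
    1 / (4 * ((151 * (L : ℝ) ^ 2) ^ j₀) ^ 2), by positivity, by positivity, fun F hFL γ hγ hγ1 b₀ hb₀ p₀ K j hjK hj0 p => ?_⟩
  subst hFL
  have hL1 : (1 : ℝ) ≤ F.L := by exact_mod_cast F.hL.2.le
  have hΛ1 := one_le_lam F
  have hΛ0 := lam_pos F
  set C : ℝ := (81 * (F.L : ℝ) ^ 3) ^ j₀ * (2 * Real.exp 24 * (c₀ ^ 3)⁻¹) * (F.L : ℝ) ^ (5 * j₀) with hC
  set c : ℝ := 1 / (4 * ((151 * (F.L : ℝ) ^ 2) ^ j₀) ^ 2) with hc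
  -- names
  set i : ℕ := K - j with hi
  have hK : K = i + j := by omega
  set βi : ℝ := (F.scheme ℰp γ).β i with hβi
  set βK : ℝ := (F.scheme ℰp γ).β K with hβK
  set θ : ℝ := θBal F.L γ b₀ p₀ i with hθ
  set pg : ℝ := B10.pFun b₀ p₀ (Real.sqrt (γ * ((F.L : ℝ)⁻¹) ^ i)) with hpg
  have hβKeq : βK = (F.L : ℝ) ^ j * βi := by rw [hβK, hK, scheme_β_add]
  have hβi1 : 1 ≤ βi := one_le_scheme_β F hγ hγ1 i
  have hβK1 : 1 ≤ βK := one_le_scheme_β F hγ hγ1 K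
  have hθ0 : 0 ≤ θ := θBal_nonneg' F hγ hγ1 hb₀ p₀ i
  have hLj1 : (1 : ℝ) ≤ (F.L : ℝ) ^ j := one_le_pow₀ hL1
  have hβθ : βi * θ ^ 2 = pg ^ 2 := beta_mul_θBal_sq F hγ b₀ p₀ i
  have hRHS0 : 0 ≤ C * βi ^ 5 * Real.exp (-(c * pg ^ 2)) := by positivity
  -- trivial case `θ > 2`: the event is empty
  by_cases hθ2 : 2 < θ
  · have hempty : {U : GaugeField (F.P K) 0 (Matrix.specialUnitaryGroup (Fin 2) ℂ) |
        θ ≤ GaugeGroup.dist1 (GaugeField.plaqHol (Averaging.iter (fun _ => BlockAveraging.blockAvg ℰp) j U) p)} = ∅ := by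
      ext U
      simp only [Set.mem_setOf_eq, Set.mem_empty_iff_false, iff_false, not_le]
      exact (dist1_le_two_specialUnitaryGroup _).trans_lt hθ2
    rw [hempty, measureReal_empty]
    exact hRHS0
  rw [not_lt] at hθ2
  -- main case: cover the event by the fine tails over the footprint
  set a : ℝ := θ / (151 * (F.L : ℝ) ^ 2) ^ j with ha
  have hΛj0 : 0 < (151 * (F.L : ℝ) ^ 2) ^ j := pow_pos hΛ0 j
  have ha0 : 0 ≤ a := div_nonneg hθ0 hΛj0.le
  obtain ⟨T, hTcard, hTbound⟩ := gibbsK_real_event_le_sum_footprint F hγ.le hjK hθ0 hθ2 p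
  refine hTbound.trans ?_
  -- the per-fine-plaquette chessboard bound (volume-uniform)
  have hterm : ∀ q : Plaq (F.P K) 0,
      (gibbsK F ℰp γ K).real {U | a ≤ GaugeGroup.dist1 (GaugeField.plaqHol U q)} ≤
        2 * Real.exp 24 * (c₀ ^ 3)⁻¹ * Real.sqrt βK ^ 9 * Real.exp (-(βK * a ^ 2 / 4)) := by
    intro q
    have hq := hch (F.P K) βK hβK1 a ha0 q
    rw [gibbsK_eq]
    refine hq.trans (le_of_eq ?_)
    rw [card_planePairs F K, show (F.P K).d = 3 from rfl]
    have hexp : βK * a ^ 2 / (2 * (2 : ℕ)) = βK * a ^ 2 / 4 := by norm_num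
    rw [hexp]
    norm_num
  have hsum : ∑ q ∈ T, (gibbsK F ℰp γ K).real {U | θ / (151 * (F.L : ℝ) ^ 2) ^ j ≤ GaugeGroup.dist1 (GaugeField.plaqHol U q)} ≤
      T.card * (2 * Real.exp 24 * (c₀ ^ 3)⁻¹ * Real.sqrt βK ^ 9 * Real.exp (-(βK * a ^ 2 / 4))) := by
    have h := Finset.sum_le_sum fun q (_ : q ∈ T) => hterm q
    rwa [Finset.sum_const, nsmul_eq_mul] at h
  refine hsum.trans ?_
  -- (i) the footprint count: `≤ (81L³)^j ≤ (81L³)^{j₀}`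
  have h81 : (1 : ℝ) ≤ 81 * (F.L : ℝ) ^ 3 := by nlinarith [one_le_pow₀ (n := 3) hL1]
  have hT' : (T.card : ℝ) ≤ (81 * (F.L : ℝ) ^ 3) ^ j₀ := hTcard.trans (pow_le_pow_right₀ h81 hj0)
  -- (ii) the polynomial prefactor: `(√βK)^9 ≤ βK^5 = L^{5j} βi^5 ≤ L^{5j₀} βi^5`
  have hsqrt : Real.sqrt βK ^ 9 ≤ (F.L : ℝ) ^ (5 * j₀) * βi ^ 5 := by
    have hs1 : 1 ≤ Real.sqrt βK := by rw [← Real.sqrt_one]; exact Real.sqrt_le_sqrt hβK1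
    have h9 : Real.sqrt βK ^ 9 ≤ Real.sqrt βK ^ 10 := pow_le_pow_right₀ hs1 (by norm_num)
    have h10 : Real.sqrt βK ^ 10 = βK ^ 5 := by
      rw [show (10 : ℕ) = 2 * 5 from rfl, pow_mul, Real.sq_sqrt (zero_le_one.trans hβK1)]
    refine h9.trans ?_
    rw [h10, hβKeq, mul_pow, ← pow_mul]
    exact mul_le_mul_of_nonneg_right (pow_le_pow_right₀ hL1 (by omega)) (by positivity)
  -- (iii) the Gaussian factor: `βK a²/4 = L^j p²/(4Λ^{2j}) ≥ c p²`
  have hgauss : Real.exp (-(βK * a ^ 2 / 4)) ≤ Real.exp (-(c * pg ^ 2)) := by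
    refine Real.exp_le_exp.mpr (neg_le_neg ?_)
    have hpg2 : 0 ≤ pg ^ 2 := sq_nonneg _
    have hkey : βK * a ^ 2 / 4 = (F.L : ℝ) ^ j * pg ^ 2 / (4 * ((151 * (F.L : ℝ) ^ 2) ^ j) ^ 2) := by
      rw [ha, hβKeq, div_pow, ← hβθ]
      field_simp
    rw [hkey, hc]
    calc 1 / (4 * ((151 * (F.L : ℝ) ^ 2) ^ j₀) ^ 2) * pg ^ 2 ≤ 1 / (4 * ((151 * (F.L : ℝ) ^ 2) ^ j) ^ 2) * pg ^ 2 := by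
          apply mul_le_mul_of_nonneg_right _ hpg2
          gcongr
      _ = 1 * pg ^ 2 / (4 * ((151 * (F.L : ℝ) ^ 2) ^ j) ^ 2) := by ring
      _ ≤ (F.L : ℝ) ^ j * pg ^ 2 / (4 * ((151 * (F.L : ℝ) ^ 2) ^ j) ^ 2) := by
          gcongr
  -- assemble
  have hpre0 : 0 ≤ 2 * Real.exp 24 * (c₀ ^ 3)⁻¹ := by positivity
  calc (T.card : ℝ) * (2 * Real.exp 24 * (c₀ ^ 3)⁻¹ * Real.sqrt βK ^ 9 * Real.exp (-(βK * a ^ 2 / 4)))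
      ≤ (81 * (F.L : ℝ) ^ 3) ^ j₀ *
        (2 * Real.exp 24 * (c₀ ^ 3)⁻¹ * ((F.L : ℝ) ^ (5 * j₀) * βi ^ 5) * Real.exp (-(c * pg ^ 2))) := by
        gcongr
    _ = C * βi ^ 5 * Real.exp (-(c * pg ^ 2)) := by rw [hC]; ring

end Main

end Summit.QuantumFields.YangMills.Theorems.HistoryTailBoundedHeightLocal

end
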